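import Summits.BirchSwinnertonDyer.BirchSwinnertonDyer.Theorems.InertBadSignedBranchesInertBadAtThreeQuarticModel
import Literature.NumberTheory.EllipticCurves.SzpiroMinimalityProofs
import Literature.NumberTheory.EllipticCurves.ModularCurveManinSemistableCoprimeFormProofs
import Literature.NumberTheory.EllipticCurves.NeronLocalHeightCompletion
import HarnessLib

/-!
# The `k`-RANGE of the quartic model: `v₃(A) ∈ {1, 2, 3}` for `C • V = (y² = x³ + Ax)` with `v₃(u_C) = 0`, `V` globally minimal bad at `3`

Summit `BirchSwinnertonDyer`, crux `InertBadAtThree` (stmt-BirchSwinnertonDyer-19225), line of record `Lines/rubin_e1_inert_three.lean`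
v5, registered stub `stub_plainOddNeronIntegralThreeQuartic`; STUB-PLAN `Cruxes/InertBadAtThree/STUB-PLAN-neronIntegralThreeQuartic-bsd-idea-18-g8.md`.
Width seat bsd-wall-cm-bed-w3 g8 (`--supports 19225`, helper), item (a) of the lead `bsd-line-ibd-p1` g7's 11:37:51Z line: the theta
dictionary's `3`-part is `χ̄₄^{v₃(A)}` and the torsion-sum integrality (P6a/b/c, bed-w1) covers `k = v₃(A) ∈ {1, 2, 3}` only, so the model
produced by `…InertBadAtThreeQuarticModel.exists_smul_eq_quartic_padicValRat_u_eq_zero` (p628739: `C • V = ⟨0,0,0,A,0⟩`, `3 ∣ A`, `v₃(u_C) = 0`)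
must be shown to have `v₃(A) ≤ 3`:

* `not_pow_four_dvd_of_smul_eq_quartic` — if `C • V = ⟨0, 0, 0, A, 0⟩` with `v₃(u_C) = 0` for a GLOBALLY MINIMAL `V`, then `3⁴ ∤ A`: otherwise the
  INTEGRAL model `(3u_C, 0, 0, 0) • V = (y² = x³ + (A/81)x)` has `v₃(Δ) = v₃(Δ_min(V)) − 12`, contradicting the minimality of `V` at `3`
  (`IsGloballyMinimal.isMinimalAt_int`, `valuation_Δ_smul_le_of_isMinimalAt`).
* `padicValInt_le_three_of_smul_eq_quartic`, and the packaged existence `exists_smul_eq_quartic_padicValInt_mem`: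
  `∃ A C, C • V = ⟨0,0,0,A,0⟩ ∧ v₃(u_C) = 0 ∧ 3 ∣ A ∧ ¬ 3⁴ ∣ A ∧ 1 ≤ v₃(A) ≤ 3`.

HONEST FRAMING: bookkeeping only; nothing here proves the stub, the crux or BSD. No definition, no named fact, no `sorry`; axioms standard.
-/

set_option autoImplicit false
set_option linter.dupNamespace false

noncomputable section

open WeierstrassCurve IsDedekindDomain
open Literature.NumberTheory.EllipticCurves
open Summit.BirchSwinnertonDyer.Rank1Residual

namespace Summit.BirchSwinnertonDyer.BirchSwinnertonDyer.Theorems.InertBadSignedBranchesInertBadAtThreeQuarticModelKRange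

open Summit.BirchSwinnertonDyer.BirchSwinnertonDyer.Theorems.InertBadSignedBranchesInertBadAtThreeQuarticModel
  (Δ_quartic exists_smul_eq_quartic_padicValRat_u_eq_zero)

/-- ★ **No fourth power of `3` in the quartic coefficient.** For a globally minimal elliptic `V/ℚ` and a change of variables `C` with
`C • V = ⟨0, 0, 0, A, 0⟩` (`A ∈ ℤ`) and `v₃(u_C) = 0`: `3⁴ ∤ A`. (Else `(3u_C, 0, 0, 0) • V = (y² = x³ + (A/81)x)` is an integral model
with `v₃(Δ) = v₃(Δ(V)) − 12 < v₃(Δ(V))`, contradicting the minimality of `V` at `3`.) [cite: SilvermanAEC2009, VII.1 Remark 1.1 and Prop. 1.3] -/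
theorem not_pow_four_dvd_of_smul_eq_quartic (V : WeierstrassCurve ℚ) [V.IsElliptic] [V.IsGloballyMinimal]
    {A : ℤ} {C : VariableChange ℚ} (hCV : C • V = ⟨0, 0, 0, (A : ℚ), 0⟩) (hu : padicValRat 3 (C.u : ℚ) = 0) :
    ¬ (3 : ℤ) ^ 4 ∣ A := by
  haveI : Fact (Nat.Prime 3) := ⟨Nat.prime_three⟩
  rintro ⟨B, hB⟩
  have hA0 : A ≠ 0 := by
    intro hA
    have hΔ : (C • V).Δ ≠ 0 := (C • V).isUnit_Δ.ne_zero
    rw [hCV, Δ_quartic, hA] at hΔ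
    norm_num at hΔ
  have hB0 : B ≠ 0 := by rintro rfl; exact hA0 (by rw [hB, mul_zero])
  -- the place `v = (3)` of `ℤ`
  set v : HeightOneSpectrum ℤ := (Rat.HeightOneSpectrum.primesEquiv (R := ℤ)).symm ⟨3, Nat.prime_three⟩ with hvdef
  have hv : Rat.HeightOneSpectrum.natGenerator v = 3 :=
    congrArg Subtype.val ((Rat.HeightOneSpectrum.primesEquiv (R := ℤ)).apply_symm_apply ⟨3, Nat.prime_three⟩)
  -- the rescaled integral model `y² = x³ + Bx`
  set S : VariableChange ℚ := ⟨Units.mk0 (3 : ℚ) (by norm_num), 0, 0, 0⟩ with hS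
  have hSC : (S * C) • V = ⟨0, 0, 0, (B : ℚ), 0⟩ := by
    rw [mul_smul, hCV, hS, X12.smul_quartic_scale]
    congr 1
    rw [hB]; push_cast
    simp only [Units.val_mk0]
    ring
  have hint : ((S * C) • V).IsIntegralAt v := by
    rw [hSC, show (⟨0, 0, 0, (B : ℚ), 0⟩ : WeierstrassCurve ℚ) = (⟨0, 0, 0, B, 0⟩ : WeierstrassCurve ℤ).baseChange ℚ by
      ext <;> simp [WeierstrassCurve.baseChange, WeierstrassCurve.map]]
    exact isIntegralAt_baseChange_int v _
  -- minimality of `V` at `3`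
  have hle := valuation_Δ_smul_le_of_isMinimalAt v (IsGloballyMinimal.isMinimalAt_int V v) (S * C) hint
  rw [hSC, Δ_quartic] at hle
  -- the two discriminants
  have hΔV : V.Δ = (C.u : ℚ) ^ 12 * (-64 * (A : ℚ) ^ 3) := by
    have h := congrArg WeierstrassCurve.Δ hCV
    rw [variableChange_Δ, Δ_quartic, Units.val_inv_eq_inv_val] at h
    have hu0 : (C.u : ℚ) ≠ 0 := C.u.ne_zero
    field_simp at h
    linear_combination h
  have hu0 : (C.u : ℚ) ≠ 0 := C.u.ne_zero
  have hA0' : (A : ℚ) ≠ 0 := by exact_mod_cast hA0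
  have hB0' : (B : ℚ) ≠ 0 := by exact_mod_cast hB0
  have hΔV0 : V.Δ ≠ 0 := by
    rw [hΔV]; exact mul_ne_zero (pow_ne_zero _ hu0) (mul_ne_zero (by norm_num) (pow_ne_zero _ hA0'))
  have hΔB0 : (-64 * (B : ℚ) ^ 3) ≠ 0 := mul_ne_zero (by norm_num) (pow_ne_zero _ hB0')
  rw [Rat.HeightOneSpectrum.valuation_eq_exp_neg_padicValRat v hΔB0,
    Rat.HeightOneSpectrum.valuation_eq_exp_neg_padicValRat v hΔV0, hv, WithZero.exp_le_exp, neg_le_neg_iff] at hle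
  -- valuations: `v₃(Δ(V)) = 3v₃(A) = 3v₃(B) + 12`, `v₃(−64B³) = 3v₃(B)`
  have h64 : padicValRat 3 (-64 : ℚ) = 0 := by
    rw [padicValRat.neg, show (64 : ℚ) = ((64 : ℕ) : ℚ) by norm_num, padicValRat.of_nat]
    norm_num [padicValNat.eq_zero_of_not_dvd]
  have hvB : padicValRat 3 (-64 * (B : ℚ) ^ 3) = 3 * padicValRat 3 (B : ℚ) := by
    rw [padicValRat.mul (by norm_num) (pow_ne_zero _ hB0'), h64, padicValRat.pow (B : ℚ)]; ring
  have h81 : padicValRat 3 ((3 : ℚ) ^ 4) = 4 := by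
    rw [padicValRat.pow (3 : ℚ)]
    have := padicValRat.self (p := 3) (by norm_num)
    push_cast at this ⊢
    rw [this]; ring
  have hvA : padicValRat 3 (A : ℚ) = 4 + padicValRat 3 (B : ℚ) := by
    rw [hB]; push_cast
    rw [padicValRat.mul (by norm_num) hB0', show (81 : ℚ) = (3 : ℚ) ^ 4 by norm_num, h81]
  have hvV : padicValRat 3 V.Δ = 12 + 3 * padicValRat 3 (B : ℚ) := by
    rw [hΔV, padicValRat.mul (pow_ne_zero _ hu0) (mul_ne_zero (by norm_num) (pow_ne_zero _ hA0')),
      padicValRat.pow (C.u : ℚ), hu, padicValRat.mul (by norm_num) (pow_ne_zero _ hA0'), h64,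
      padicValRat.pow (A : ℚ), hvA]
    ring
  rw [hvB, hvV] at hle
  linarith

/-- ★ `v₃(A) ≤ 3` for such a model (`A ≠ 0`). [cite: SilvermanAEC2009, VII.1 Remark 1.1] -/
theorem padicValInt_le_three_of_smul_eq_quartic (V : WeierstrassCurve ℚ) [V.IsElliptic] [V.IsGloballyMinimal]
    {A : ℤ} {C : VariableChange ℚ} (hCV : C • V = ⟨0, 0, 0, (A : ℚ), 0⟩) (hu : padicValRat 3 (C.u : ℚ) = 0) :
    padicValInt 3 A ≤ 3 := by
  haveI : Fact (Nat.Prime 3) := ⟨Nat.prime_three⟩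
  by_contra h
  have h4 : 4 ≤ padicValInt 3 A := by omega
  have := (padicValInt_dvd_iff (p := 3) 4 A).mpr (Or.inr h4)
  exact not_pow_four_dvd_of_smul_eq_quartic V hCV hu (by exact_mod_cast this)

/-- ★ **The quartic model with its `k`-range.** Every globally minimal elliptic `V/ℚ` with `j(V) = 1728` bad at `3` has a model
`C • V = ⟨0, 0, 0, A, 0⟩` with `v₃(u_C) = 0`, `3 ∣ A`, `3⁴ ∤ A` — i.e. `k = v₃(A) ∈ {1, 2, 3}` (Kodaira III, I₀*, III* at `3`).
[cite: SilvermanAEC2009, X.5.4 (iii) and VII.1 Remark 1.1] -/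
theorem exists_smul_eq_quartic_padicValInt_mem (V : WeierstrassCurve ℚ) [V.IsElliptic] [V.IsGloballyMinimal]
    (hj : V.j = 1728) (hbad : ¬ V.HasGoodReductionAtPrime 3) :
    ∃ (A : ℤ) (C : VariableChange ℚ), C • V = ⟨0, 0, 0, (A : ℚ), 0⟩ ∧ padicValRat 3 (C.u : ℚ) = 0 ∧
      (3 : ℤ) ∣ A ∧ ¬ (3 : ℤ) ^ 4 ∣ A ∧ 1 ≤ padicValInt 3 A ∧ padicValInt 3 A ≤ 3 := by
  haveI : Fact (Nat.Prime 3) := ⟨Nat.prime_three⟩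
  obtain ⟨A, C, hCV, h3A, hu⟩ := exists_smul_eq_quartic_padicValRat_u_eq_zero V hj hbad
  have hA0 : A ≠ 0 := by
    intro hA
    have hΔ : (C • V).Δ ≠ 0 := (C • V).isUnit_Δ.ne_zero
    rw [hCV, Δ_quartic, hA] at hΔ
    norm_num at hΔ
  refine ⟨A, C, hCV, hu, h3A, not_pow_four_dvd_of_smul_eq_quartic V hCV hu, ?_,
    padicValInt_le_three_of_smul_eq_quartic V hCV hu⟩
  have := (padicValInt_dvd_iff (p := 3) 1 A).mp (by simpa using h3A)
  rcases this with h | h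
  · exact absurd h hA0
  · exact h

end Summit.BirchSwinnertonDyer.BirchSwinnertonDyer.Theorems.InertBadSignedBranchesInertBadAtThreeQuarticModelKRange

end
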